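import Literature.MathematicalPhysics.QuantumFieldTheory.Federbush1986.PureAveragesUNLemma12
import Literature.Analysis.Calculus.ExpDuhamel

/-!
# `Federbush1986.PureAveragesUNLemma13` — P. Federbush, *A phase cell approach to Yang–Mills theory. III. Local stability,
# modified renormalization group transformation*, Commun. Math. Phys. **110** (1987) 293–309 [Federbush1987PhaseCellIII],
# §1 **Lemma 1.3** (1.12) «x = 0 ⇔ ΣA_i = 0» p. 295–296 — the direction **«x = 0 ⇒ ΣA_i = 0» PROVED for the model instance
# `G = U(N)`, every `N`** (`UN.sum_eq_zero_of_isPureAverage_one`), together with the FIRST-VARIATION FORMULA of the length at the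
# identity (`UN.frobB_deriv_gaussCurve`, `UN.fderiv_FLem_zero_of_small`) and its group form, BAŁABAN'S AVERAGING EQUATION
# `Σ_i log(ḡ^*g_i) = 0` for a pure average `ḡ` in `U(N)` (`UN.sum_mlog_rel_eq_zero_of_isPureAverage`)

statement-level skeleton of published theorems with citation tags; proofs where landed; nothing here is a claim about the Yang–Mills mass gap

PDF held: `fed1987-cmp110-III` (scan `run/shared/lean/pub/pub-balaban/t4/b2b-balaban-t4-lit2/pdf/fed1987-cmp110-III.pdf`, renders
`run/shared/lean/pub/lit-balaban/lit-balaban-r17/renders/fedIII/fed1987-cmp110-III-p003-x2.png` (p. 295) and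
`…/b2b-balaban-t4-lit2/renders/fed1987III/fed1987-cmp110-III-p004-x2.png` (p. 296)), read as images.

CITATION HEADER (lean-in-tree rule).  lit-balaban cell (HOME `run/shared/lean/pub/lit-balaban/`), SKELETON row **F3.Lem1.3** (reader
r17; statement `…Federbush1986.PureAverages.Lemma13` = the EQUIVALENCE «x = 0 ⇔ ΣA_i = 0», p238910, untouched and NOT closed here:
only the direction `⇒` is proved for `U(N)` — the converse needs the uniqueness of the pure average in a small ball, which is not
in this file); Phase-2 seat p12 (gen 6), unit `lit-balaban-p12`, kind «model-instance / generality upgrade», over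
`…Federbush1986.PureAveragesUNLemma12` (first-order condition `UN.first_order_condition`, `InnerProductSpace ℝ (uN N)`),
`…PureAveragesUNLemma11` (`UN.FLem`, `UN.differentiableAt_FLem`, `UN.dist_expUN_eq`) and the tree's Duhamel formula
`…Analysis.Calculus.ExpDuhamel.hasDerivAt_exp_comp` (Hall (5.11)); the tree proves the full row for `G = SU(2)`
(`…PureAveragesSU2Lemma13`, p32).  INTERFACE: the conclusion `Σ_i log(ḡ⁻¹g_i) = 0` is (0.10) of [Balaban1987RG1] «proved by
Federbush», constructed and solved in the tree by `Balaban1983to89/BlockAveragingFederbush*`; this file derives it from Federbush's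
DEFINITION (1.1)–(1.2) for `U(N)`.

THE PRINT (p. 295–296): *"Lemma 1.3. x = 0 ⇔ Σ A_i = 0. (1.12)  This surprising result follows by noting that …"* (print argues with
the symmetry of `d`; here the direction `⇒` is the first-order condition of the minimiser).

THE PROOF GIVEN HERE.  §1 `Ad`-invariance of the pairing against a skew `B`: `⟨B, E₁WE₂⟩ = ⟨B, W⟩` when `[B, E₁] = 0`, `E₂E₁ = 1`
(`frobB_conj_eq`; `E₁ = e^{−rB}`, `E₂ = e^{rB}`: `frobB_conj_exp`).  §2 the first-variation formula: with `γ(t) = log(e^{−tV}e^B)`,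
differentiating `e^{γ(t)} = e^{−tV}e^B` at `t = 0` with Duhamel's `(e^γ)′ = e^{γ}∫₀¹ e^{−rγ}γ′e^{rγ}dr` gives
`∫₀¹ e^{−rB}γ′(0)e^{rB}dr = −e^{−B}Ve^{B}`, and pairing with `B` (the pairing commutes with the integral, Mathlib
`ContinuousLinearMap.intervalIntegral_comp_comm`) yields `⟨B, γ′(0)⟩ = −⟨B, V⟩` (`frobB_deriv_gaussCurve`).  §3 hence
`d/dt|₀ (d²(e^{tV}, e^B) − |B − tV|²) = 2⟨B, γ′(0)⟩ + 2⟨B, V⟩ = 0` for every direction: `dF_B(0) = 0` (`fderiv_FLem_zero_of_small`,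
`|B| < 1/100`).  §4 the first-order condition of Lemma 1.2 at `x = 0` then reads `Σ_i ⟨A_i, V⟩ = 0` for all `V`, i.e. `ΣA_i = 0`
(`sum_eq_zero_of_isPureAverage_one`); translating a general pure average `ḡ` to `1` (`isPureAverage_iff_one`) with
`A_i = log(ḡ^*g_i) ∈ 𝔲(N)` gives `Σ_i log(ḡ^*g_i) = 0` (`sum_mlog_rel_eq_zero_of_isPureAverage`, steps `|ḡ^*g_i − 1|_F < 1/200`).
Constants `1/100`, `1/200` are this file's.  Deliberately NOT here: the direction `⇐` of (1.12) and Proposition 5.9 for `U(N)`.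
-/

namespace Literature.MathematicalPhysics.QuantumFieldTheory.Federbush1986

open scoped Matrix.Norms.Frobenius ComplexConjugate Matrix Topology
open NormedSpace Metric Set Filter UNGauss
open Literature.MathematicalPhysics.QuantumFieldTheory.Balaban1983to89.MatrixLog (mlog mlog_def mlog_one exp_mlog
  analyticAt_mlog norm_mlog_le_two_mul norm_sub_one_le_two_mul_norm_mlog)
open Literature.MathematicalPhysics.QuantumFieldTheory.Balaban1983to89.B7BlockAvgLog (mlog_exp)

noncomputable section

namespace UN

variable {N : ℕ}

/-! ## §1 `Ad`-invariance of the pairing against a skew `B`: `⟨B, E₁ W E₂⟩ = ⟨B, W⟩` -/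

/-- `⟨B, E₁ W E₂⟩ = ⟨B, W⟩` whenever `B` is skew, commutes with `E₁`, and `E₂E₁ = 1` (cyclicity of the trace) — used with
`E₁ = e^{−rB}`, `E₂ = e^{rB}`. [cite: Federbush1987PhaseCellIII, Lemma 1.3 (1.12) p. 295–296] -/
theorem frobB_conj_eq {B E₁ E₂ : 𝕄 N} (hB : star B = -B) (hc : Commute B E₁) (hinv : E₂ * E₁ = 1) (W : 𝕄 N) :
    frobB B (E₁ * W * E₂) = frobB B W := by
  have hBh : Bᴴ = -B := by rw [← Matrix.star_eq_conjTranspose]; exact hB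
  rw [frobB_apply, frobB_apply, hBh, neg_mul, neg_mul, Matrix.trace_neg, Matrix.trace_neg,
    show B * (E₁ * W * E₂) = (B * E₁ * W) * E₂ by simp only [mul_assoc], Matrix.trace_mul_comm, hc.eq,
    show E₂ * (E₁ * B * W) = (E₂ * E₁) * (B * W) by simp only [mul_assoc], hinv, one_mul]

/-- `e^{rB} e^{−rB} = 1`. [cite: Federbush1987PhaseCellIII, Lemma 1.3 (1.12) p. 295–296] -/
theorem exp_smul_mul_exp_neg_smul (B : 𝕄 N) (r : ℝ) : exp (r • B) * exp (-(r • B)) = 1 :=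
  calc exp (r • B) * exp (-(r • B)) = exp (r • B + -(r • B)) := (exp_add_of_commute (Commute.refl _).neg_right).symm
    _ = 1 := by rw [add_neg_cancel, exp_zero]

/-- `⟨B, e^{−rB} W e^{rB}⟩ = ⟨B, W⟩` for skew `B`. [cite: Federbush1987PhaseCellIII, Lemma 1.3 (1.12) p. 295–296] -/
theorem frobB_conj_exp (B W : 𝕄 N) (hB : star B = -B) (r : ℝ) :
    frobB B (exp (-(r • B)) * W * exp (r • B)) = frobB B W :=
  frobB_conj_eq hB (((Commute.refl B).smul_right r).neg_right.exp_right) (exp_smul_mul_exp_neg_smul B r) W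

/-! ## §2 The first-variation formula at the identity (Gauss lemma): `⟨B, d/dt log(e^{−tV}e^B)|₀⟩ = −⟨B, V⟩` -/

/-- The curve `γ(t) = log(e^{−tV} e^B)` in the matrix algebra. [cite: Federbush1987PhaseCellIII, Lemma 1.3 (1.12) p. 295–296] -/
def gaussCurve (B V : 𝕄 N) (t : ℝ) : 𝕄 N := mlog (exp (-(t • V)) * exp B)

/-- `γ(0) = B` (`|B| < ln 2`). [cite: Federbush1987PhaseCellIII, Lemma 1.3 (1.12) p. 295–296] -/
theorem gaussCurve_zero {B : 𝕄 N} (V : 𝕄 N) (hB : ‖B‖ < Real.log 2) : gaussCurve B V 0 = B := by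
  have h : mlog (exp B) = B := mlog_exp hB
  rw [gaussCurve, zero_smul, neg_zero, exp_zero, one_mul]
  exact h

/-- `γ` is differentiable at every `t` with `|tV| + |B| ≤ 1/5`. [cite: Federbush1987PhaseCellIII, Lemma 1.3 (1.12) p. 295–296] -/
theorem differentiableAt_gaussCurve {B V : 𝕄 N} {t : ℝ} (h : ‖-(t • V)‖ + ‖B‖ ≤ 1 / 5) :
    DifferentiableAt ℝ (gaussCurve B V) t := by
  have h1 : DifferentiableAt ℝ (fun t : ℝ => -(t • V)) t := (differentiableAt_id.smul_const V).neg
  have h2 : DifferentiableAt ℝ (fun t : ℝ => exp (-(t • V)) * exp B) t :=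
    (((exp_analytic (𝕂 := ℝ) (-(t • V))).differentiableAt).comp t h1).mul_const (exp B)
  have h3 := ((analyticAt_mlog (norm_exp_mul_exp_sub_one_lt_one h)).differentiableAt.restrictScalars ℝ).comp t h2
  exact h3

/-- **First variation of the length at the identity**: for skew `B` and any `V` with `|V| + |B| ≤ 1/5`,
`⟨B, γ′(0)⟩ = −⟨B, V⟩` where `γ(t) = log(e^{−tV}e^B)` — by Duhamel's formula for `d exp` (tree
`Analysis.Calculus.hasDerivAt_exp_comp`, Hall (5.11)) applied to `e^{γ(t)} = e^{−tV}e^B` and `Ad`-invariance of `⟨B, ·⟩`.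
[cite: Federbush1987PhaseCellIII, Lemma 1.3 (1.12) p. 295–296] -/
theorem frobB_deriv_gaussCurve {B V : 𝕄 N} (hB : star B = -B) (h : ‖V‖ + ‖B‖ ≤ 1 / 5) :
    frobB B (deriv (gaussCurve B V) 0) = -frobB B V := by
  have hB5 : ‖B‖ ≤ 1 / 5 := by linarith [norm_nonneg V]
  have hBlog : ‖B‖ < Real.log 2 := by have := Real.log_two_gt_d9; linarith
  have h0 : ‖-((0 : ℝ) • V)‖ + ‖B‖ ≤ 1 / 5 := by rw [zero_smul, neg_zero, norm_zero, zero_add]; exact hB5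
  have hγ : HasDerivAt (gaussCurve B V) (deriv (gaussCurve B V) 0) 0 := (differentiableAt_gaussCurve h0).hasDerivAt
  have hγ0 : gaussCurve B V 0 = B := gaussCurve_zero V hBlog
  -- Duhamel: `(e^γ)'(0) = e^B ∫₀¹ e^{-rB} γ'(0) e^{rB} dr`
  have hD := Literature.Analysis.Calculus.hasDerivAt_exp_comp hγ
  rw [hγ0] at hD
  -- the same function is `t ↦ e^{t(−V)} e^B` near `0`, with derivative `−V e^B`
  have hR : HasDerivAt (fun t : ℝ => exp (t • (-V)) * exp B) (-V * exp ((0 : ℝ) • -V) * exp B) 0 :=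
    (hasDerivAt_exp_smul_const' (𝕂 := ℝ) (-V) 0).mul_const (exp B)
  have hEq : (fun t : ℝ => exp (t • (-V)) * exp B) =ᶠ[𝓝 0] fun s => exp (gaussCurve B V s) := by
    filter_upwards [Metric.ball_mem_nhds (0 : ℝ) one_pos] with s hs
    rw [Metric.mem_ball, dist_zero_right, Real.norm_eq_abs] at hs
    have hsV : ‖s • (-V)‖ ≤ ‖V‖ := by
      rw [norm_smul, norm_neg, Real.norm_eq_abs]; exact mul_le_of_le_one_left (norm_nonneg V) hs.le
    have hlt : ‖exp (s • (-V)) * exp B - 1‖ < 1 := norm_exp_mul_exp_sub_one_lt_one (by linarith)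
    have e : exp (mlog (exp (s • (-V)) * exp B)) = exp (s • (-V)) * exp B := exp_mlog hlt
    rw [gaussCurve, show -(s • V) = s • (-V) by rw [smul_neg]]
    exact e.symm
  have hD' := hR.congr_of_eventuallyEq hEq.symm
  have E := hD.unique hD'
  rw [zero_smul, exp_zero, mul_one] at E
  -- cancel `e^B` on the left and pair with `B`
  have hinv : exp (-B) * exp B = 1 :=
    calc exp (-B) * exp B = exp (-B + B) := (exp_add_of_commute (Commute.refl B).neg_left).symm
      _ = 1 := by rw [neg_add_cancel, exp_zero]
  have E2 : (∫ r in (0 : ℝ)..1, exp (-(r • B)) * deriv (gaussCurve B V) 0 * exp (r • B)) = exp (-B) * (-V) * exp B :=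
    calc (∫ r in (0 : ℝ)..1, exp (-(r • B)) * deriv (gaussCurve B V) 0 * exp (r • B))
        = exp (-B) * exp B * ∫ r in (0 : ℝ)..1, exp (-(r • B)) * deriv (gaussCurve B V) 0 * exp (r • B) := by
          rw [hinv, one_mul]
      _ = exp (-B) * (exp B * ∫ r in (0 : ℝ)..1, exp (-(r • B)) * deriv (gaussCurve B V) 0 * exp (r • B)) := mul_assoc _ _ _
      _ = exp (-B) * (-V * exp B) := congrArg (fun M => exp (-B) * M) E
      _ = exp (-B) * (-V) * exp B := (mul_assoc _ _ _).symm
  have hcont : Continuous fun r : ℝ => exp (-(r • B)) * deriv (gaussCurve B V) 0 * exp (r • B) := by fun_prop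
  have E3 : (∫ r in (0 : ℝ)..1, frobB B (exp (-(r • B)) * deriv (gaussCurve B V) 0 * exp (r • B)))
      = frobB B (exp (-B) * (-V) * exp B) :=
    ((frobB B).intervalIntegral_comp_comm (hcont.intervalIntegrable 0 1)).trans (congrArg (fun M => frobB B M) E2)
  have E4 : (∫ r in (0 : ℝ)..1, frobB B (exp (-(r • B)) * deriv (gaussCurve B V) 0 * exp (r • B)))
      = ∫ _ in (0 : ℝ)..1, frobB B (deriv (gaussCurve B V) 0) :=
    intervalIntegral.integral_congr fun r _ => frobB_conj_exp B _ hB r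
  rw [E4, intervalIntegral.integral_const, sub_zero, one_smul] at E3
  rw [E3]
  have h1 := frobB_conj_eq (E₁ := exp (-B)) (E₂ := exp B) hB (Commute.refl B).neg_right.exp_right
    (exp_smul_mul_exp_neg_smul B 1 ▸ by rw [one_smul]) (-V)
  rw [map_neg] at h1
  exact h1

/-! ## §3 `dF_B(0) = 0`: the Lemma-1.1 correction is critical at the identity -/

/-- `(t V)` on matrices. [cite: Federbush1987PhaseCellIII, Lemma 1.3 (1.12) p. 295–296] -/
theorem val_smul (t : ℝ) (V : uN N) : (t • V).val = t • V.val := rfl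

/-- `(B − t V)` on matrices. [cite: Federbush1987PhaseCellIII, Lemma 1.3 (1.12) p. 295–296] -/
theorem val_sub_smul (B V : uN N) (t : ℝ) : (B - t • V).val = B.val - t • V.val := rfl

/-- **`dF_B(0) = 0`** for every `B ∈ 𝔲(N)` with `|B| < 1/100`: along each line `tV`, `F_B(tV) = |γ(t)|² − |B − tV|²` has
derivative `2⟨B, γ′(0)⟩ + 2⟨B, V⟩ = 0` by the first-variation formula. [cite: Federbush1987PhaseCellIII, Lemma 1.3 (1.12) p. 295–296] -/
theorem fderiv_FLem_zero_of_small {B : uN N} (hB : ‖B‖ < 1 / 100) : fderiv ℝ (FLem B) 0 = 0 := by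
  letI : InnerProductSpace ℝ (𝕄 N) := frobInnerProductSpace
  ext V
  rw [_root_.zero_apply]
  rcases eq_or_ne V 0 with hV | hV
  · rw [hV, map_zero]
  -- rescale the direction so that `|V| + |B| ≤ 1/5`
  have hVn : 0 < ‖V‖ := norm_pos_iff.mpr hV
  set c : ℝ := (200 * ‖V‖)⁻¹ with hc
  have hc0 : 0 < c := by positivity
  set W : uN N := c • V with hW
  have hWn : ‖W‖ = 1 / 200 := by
    rw [hW, norm_smul, Real.norm_of_nonneg hc0.le, hc]; field_simp
  suffices hWz : fderiv ℝ (FLem B) 0 W = 0 by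
    have : fderiv ℝ (FLem B) 0 V = c⁻¹ * fderiv ℝ (FLem B) 0 W := by
      rw [hW, map_smul, smul_eq_mul, ← mul_assoc, inv_mul_cancel₀ hc0.ne', one_mul]
    rw [this, hWz, mul_zero]
  have hsmall : ‖W.val‖ + ‖B.val‖ ≤ 1 / 5 := by rw [← uN.norm_def, ← uN.norm_def, hWn]; linarith
  -- the curve and the two squared norms
  have h0 : ‖-((0 : ℝ) • W.val)‖ + ‖B.val‖ ≤ 1 / 5 := by
    rw [zero_smul, neg_zero, norm_zero, zero_add, ← uN.norm_def]; linarith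
  have hγ : HasDerivAt (gaussCurve B.val W.val) (deriv (gaussCurve B.val W.val) 0) 0 :=
    (differentiableAt_gaussCurve h0).hasDerivAt
  have hγ0 : gaussCurve B.val W.val 0 = B.val :=
    gaussCurve_zero W.val (by rw [← uN.norm_def]; have := Real.log_two_gt_d9; linarith)
  have hfv := frobB_deriv_gaussCurve B.star_val hsmall
  have h1 := hγ.norm_sq
  rw [hγ0] at h1
  have h2 := (((hasDerivAt_id' (0 : ℝ)).smul_const W.val).const_sub B.val).norm_sq
  simp only [one_smul, zero_smul, sub_zero] at h2
  have h3 := h1.sub h2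
  have hzero : 2 * inner ℝ B.val (deriv (gaussCurve B.val W.val) 0) - 2 * inner ℝ B.val (-W.val) = 0 := by
    show 2 * frobB B.val (deriv (gaussCurve B.val W.val) 0) - 2 * frobB B.val (-W.val) = 0
    rw [hfv, map_neg]; ring
  rw [hzero] at h3
  -- `F_B(tW)` is this difference near `t = 0`
  have hev : (fun t : ℝ => FLem B (t • W)) =ᶠ[𝓝 0] fun t => ‖gaussCurve B.val W.val t‖ ^ 2 - ‖B.val - t • W.val‖ ^ 2 := by
    filter_upwards [Metric.ball_mem_nhds (0 : ℝ) one_pos] with t ht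
    rw [Metric.mem_ball, dist_zero_right, Real.norm_eq_abs] at ht
    have hts : ‖t • W‖ + ‖B‖ ≤ 1 / 50 := by
      rw [norm_smul, Real.norm_eq_abs, hWn]
      have : |t| * (1 / 200) ≤ 1 / 200 := by nlinarith [abs_nonneg t]
      linarith
    rw [FLem, dist_expUN_eq _ _ hts, uN.norm_def (B - t • W), val_sub_smul, val_smul, gaussCurve]
  have h4 : HasDerivAt (fun t : ℝ => FLem B (t • W)) 0 0 := h3.congr_of_eventuallyEq hev
  -- compare with the chain rule through `fderiv`
  have hline : HasDerivAt (fun t : ℝ => t • W) W 0 := by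
    have := (hasDerivAt_id' (0 : ℝ)).smul_const W; rwa [one_smul] at this
  have h5 : HasDerivAt (fun t : ℝ => FLem B (t • W)) (fderiv ℝ (FLem B) 0 W) 0 :=
    (differentiableAt_FLem (by rw [norm_zero]; norm_num) hB).hasFDerivAt.comp_hasDerivAt_of_eq (0 : ℝ) hline
      (by rw [zero_smul])
  exact h5.unique h4

/-! ## §4 Lemma 1.3, direction `⇒`, for `G = U(N)`: a pure average at the identity has `ΣA_i = 0` -/

/-- **Lemma 1.3 (⇒) for `G = U(N)`** («x = 0 ⇒ ΣA_i = 0»): if `1 = e^0` is a pure average of `e^{A_1}, …, e^{A_n}`, `|A_i| < 1/100`,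
then `Σ_i A_i = 0` — the first-order condition (`UN.first_order_condition`) at `x = 0`, where `dF_{A_i}(0) = 0`
(`fderiv_FLem_zero_of_small`).  This is the equation of Bałaban's averaging ((0.10) of CMP 109) for the group `U(N)`.
[cite: Federbush1987PhaseCellIII, Lemma 1.3 (1.12) p. 295–296] -/
theorem sum_eq_zero_of_isPureAverage_one {n : ℕ} {A : Fin n → uN N} (hA : ∀ i, ‖A i‖ < 1 / 100)
    (h : IsPureAverage (fun i => expUN (A i)) 1) : ∑ i, A i = 0 := by
  have h' : IsPureAverage (fun i => expUN (A i)) (expUN 0) := by rwa [expUN_zero]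
  have hfoc := first_order_condition hA (by rw [norm_zero]; norm_num) h'
  apply ext_inner_right ℝ
  intro V
  rw [inner_zero_left, sum_inner]
  have hV : ∑ i, 2 * inner ℝ (A i) V = 0 := by
    have h2 := hfoc V
    simp only [sub_zero, fderiv_FLem_zero_of_small (hA _), _root_.zero_apply] at h2
    exact h2
  rw [← Finset.mul_sum] at hV
  exact (mul_eq_zero.mp hV).resolve_left two_ne_zero

/-- **Bałaban's averaging equation from Federbush's pure average, for `U(N)`**: if `ḡ` is a pure average (1.1)–(1.2) of
`g_1, …, g_n ∈ U(N)` with every `|ḡ^*g_i − 1|_F < 1/200`, then `Σ_i log(ḡ^*g_i) = 0` («yields "Balaban averaging"», VI p. 19;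
(0.10) of [Balaban1987RG1]).  Left translation to `ḡ = 1` (`isPureAverage_iff_one`) and Lemma 1.3 (⇒).
[cite: Federbush1987PhaseCellIII, Lemma 1.3 (1.12) p. 295–296] -/
theorem sum_mlog_rel_eq_zero_of_isPureAverage {n : ℕ} {g : Fin n → UN N} {gbar : UN N}
    (hclose : ∀ i, stepSize gbar (g i) < 1 / 200) (h : IsPureAverage g gbar) : ∑ i, mlog (rel gbar (g i)) = 0 := by
  have hskew : ∀ i, star (mlog (rel gbar (g i))) = -mlog (rel gbar (g i)) := fun i =>
    star_mlog_of_mem_unitaryGroup (rel_mem gbar (g i)) (lt_trans (hclose i) (by norm_num))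
  set A : Fin n → uN N := fun i => uN.mk (mlog (rel gbar (g i))) (hskew i) with hAdef
  have hAval : ∀ i, (A i).val = mlog (rel gbar (g i)) := fun i => rfl
  have hexp : ∀ i, expUN (A i) = gbar⁻¹ * g i := fun i => UN.ext (by
    rw [expUN_val, hAval, mul_val, inv_val, ← rel_def]
    exact exp_mlog (lt_trans (hclose i) (by norm_num)))
  have hA : ∀ i, ‖A i‖ < 1 / 100 := fun i => by
    rw [uN.norm_def, hAval]
    have := cost_le_two_mul_stepSize (le_of_lt (lt_trans (hclose i) (by norm_num)))
    rw [cost_def] at this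
    linarith [hclose i]
  have h1 : IsPureAverage (fun i => expUN (A i)) 1 := by
    have := (isPureAverage_iff_one g gbar).mp h
    simp_rw [hexp]
    exact this
  have hsum := sum_eq_zero_of_isPureAverage_one hA h1
  have h2 := congrArg uN.val hsum
  rw [show uN.val (∑ i, A i) = ∑ i, (A i).val from Submodule.coe_sum _ _ _,
    show uN.val (0 : uN N) = 0 from rfl] at h2
  simpa only [hAval] using h2

end UN

end

end Literature.MathematicalPhysics.QuantumFieldTheory.Federbush1986
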